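import Summits.Ventures.PercRepro.RankLevelSetHallRuleQ

/-!
# PercRepro — C-044, UP FORM: ANY FRACTIONAL Φ-MATCHING GIVES THE HALL CONDITION; RULE L (the LYM split on the middle
levels, the big sets to the members whose closure they enter) — the mechanism that pays where Rule Q dies (night-1, gen 15;
dossier §26.2)

`hallUp_of_ruleQ` (g13) is the double count for ONE rule (the equal split).  THIS FILE states it once for EVERY rule: a weight
`w Z S ≥ 0` supported on the pairs `Z ⊆ S`, giving every member at least `Φ(p,q)` in total and loading every `Y`-set at most `1`,
yields the UP-Hall condition for every family of members (`hallUp_of_fracMatching`).  Then RULE L: at the tight layer every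
middle-level `Y`-set `S` (`#S < p`) gives `1 / C(#S, q)` to each member inside it (the Boolean LYM split), and every big `Y`-set
(`#S ≥ p`) splits one unit equally among its ELIGIBLE members — the `Z ⊆ S` with an element of `S ∖ Z` in `cl Z`
(`eligCount M p q S` of them).  `RuleLUp M p q` (a `Prop`, NOT asserted): every member receives at least `Φ(p,q)`.
Paper / census (night-1 g15, own exact code, dossier §26.2): Rule L is EXACT on the model family `T_p(U_{q,F} ⊕ free)` — where
Rule Q fails from `#E = 158` — and holds on every loopless matroid at the tight layer with `n ≤ 9` (1,680 matroids, 0 failures,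
worst ratio exactly 1) and on the 10- / 14-element witnesses of §23.3; it is NOT proved.  The conditional theorem is
`hallUp_of_ncard_eq_of_ruleL`: at `#E = p + q`, `RuleLUp M p q` gives the UP-Hall condition for every family.

* `hallUp_of_fracMatching` — the general double count;
* `eligCount`, `ruleLWeight`, `ruleLRecv`, `RuleLUp` — Rule L;
* `ncard_members_subset_le_choose` — at the tight layer a set `S` contains at most `C(#S, q)` members;
* `ruleLWeight_load_le_one` — every `Y`-set is loaded at most `1` under Rule L (at the tight layer);
* **`hallUp_of_ncard_eq_of_ruleL`** — `#E = p + q`, `RuleLUp M p q` ⇒ the UP-Hall condition for every family of members.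
Axioms: standard.
-/

namespace PercRepro

open Set Matroid Finset

variable {α : Type} (M : Matroid α) [M.Finite]

/-- **Any fractional `Φ`-matching gives the UP-Hall condition**: weights `w Z S ≥ 0` supported on pairs `Z ⊆ S`, every member
receiving at least `Φ(p,q)` over the `Y`-sets, every `Y`-set loaded at most `1` over the members. -/
theorem hallUp_of_fracMatching (p q : ℕ) (w : Set α → Set α → ℚ) (hnn : ∀ Z S, 0 ≤ w Z S)
    (hsupp : ∀ Z S, w Z S ≠ 0 → Z ⊆ S)
    (hdem : ∀ Z ∈ cellMembers M p q, phiK p q ≤ ∑ S ∈ (cellY_finite M p q).toFinset, w Z S)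
    (hcap : ∀ S ∈ cellY M p q, ∑ Z ∈ (cellMembers_finite M p q).toFinset, w Z S ≤ 1)
    (𝒜 : Set (Set α)) (h𝒜 : 𝒜 ⊆ cellMembers M p q) :
    phiK p q * (𝒜.ncard : ℚ) ≤ ((upNbhd M p q 𝒜).ncard : ℚ) := by
  classical
  have h𝒜fin : 𝒜.Finite := (cellMembers_finite M p q).subset h𝒜
  set 𝒜f : Finset (Set α) := h𝒜fin.toFinset with h𝒜f
  set Yf : Finset (Set α) := (cellY_finite M p q).toFinset with hYf
  set Mf : Finset (Set α) := (cellMembers_finite M p q).toFinset with hMf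
  have h𝒜card : (𝒜.ncard : ℚ) = (𝒜f.card : ℚ) := by
    rw [h𝒜f, ncard_eq_toFinset_card _ h𝒜fin]
  have h𝒜M : 𝒜f ⊆ Mf := by
    intro Z hZ
    rw [h𝒜f, h𝒜fin.mem_toFinset] at hZ
    rw [hMf, (cellMembers_finite M p q).mem_toFinset]
    exact h𝒜 hZ
  -- step 1: Φ·#𝒜 ≤ Σ_{Z ∈ 𝒜} Σ_S w Z S
  have h1 : phiK p q * (𝒜f.card : ℚ) ≤ ∑ Z ∈ 𝒜f, ∑ S ∈ Yf, w Z S := by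
    rw [mul_comm, ← nsmul_eq_mul, ← Finset.sum_const]
    refine Finset.sum_le_sum (fun Z hZ => ?_)
    rw [h𝒜f, h𝒜fin.mem_toFinset] at hZ
    exact hdem Z (h𝒜 hZ)
  -- step 2: each S contributes at most the indicator of «S contains a member of 𝒜»
  have h3 : ∀ S ∈ Yf, ∑ Z ∈ 𝒜f, w Z S ≤ (if ∃ Z ∈ 𝒜, Z ⊆ S then (1 : ℚ) else 0) := by
    intro S hS
    rw [hYf, (cellY_finite M p q).mem_toFinset] at hS
    by_cases hex : ∃ Z ∈ 𝒜, Z ⊆ S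
    · rw [if_pos hex]
      calc ∑ Z ∈ 𝒜f, w Z S ≤ ∑ Z ∈ Mf, w Z S :=
            Finset.sum_le_sum_of_subset_of_nonneg h𝒜M (fun Z _ _ => hnn Z S)
        _ ≤ 1 := hcap S hS
    · rw [if_neg hex]
      apply le_of_eq
      apply Finset.sum_eq_zero
      intro Z hZ
      rw [h𝒜f, h𝒜fin.mem_toFinset] at hZ
      by_contra hne
      exact hex ⟨Z, hZ, hsupp Z S hne⟩
  -- step 3: the indicators sum to the size of the UP-neighbourhood
  have h4 : ∑ S ∈ Yf, (if ∃ Z ∈ 𝒜, Z ⊆ S then (1 : ℚ) else 0) = ((upNbhd M p q 𝒜).ncard : ℚ) := by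
    rw [Finset.sum_ite, Finset.sum_const_zero, add_zero, Finset.sum_const, nsmul_eq_mul, mul_one]
    have hU : upNbhd M p q 𝒜 = ((Yf.filter (fun S => ∃ Z ∈ 𝒜, Z ⊆ S) : Finset (Set α)) : Set (Set α)) := by
      ext S
      rw [Finset.coe_filter, hYf, Set.mem_setOf_eq, (cellY_finite M p q).mem_toFinset]
      constructor
      · intro hS
        exact ⟨⟨hS.1, hS.2.1, hS.2.2.1⟩, hS.2.2.2⟩
      · intro hS
        exact ⟨hS.1.1, hS.1.2.1, hS.1.2.2, hS.2⟩
    rw [hU, ncard_coe_finset]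
  calc phiK p q * (𝒜.ncard : ℚ) = phiK p q * (𝒜f.card : ℚ) := by rw [h𝒜card]
    _ ≤ ∑ Z ∈ 𝒜f, ∑ S ∈ Yf, w Z S := h1
    _ = ∑ S ∈ Yf, ∑ Z ∈ 𝒜f, w Z S := Finset.sum_comm
    _ ≤ ∑ S ∈ Yf, (if ∃ Z ∈ 𝒜, Z ⊆ S then (1 : ℚ) else 0) := Finset.sum_le_sum h3
    _ = ((upNbhd M p q 𝒜).ncard : ℚ) := h4

/-- The **eligible members** of `S`: the members `Z ⊆ S` with an element of `S ∖ Z` in `cl Z` (`r(insert e Z) = q`). -/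
noncomputable def eligCount (M : Matroid α) (p q : ℕ) (S : Set α) : ℕ :=
  {Z : Set α | Z ∈ cellMembers M p q ∧ Z ⊆ S ∧ ∃ e ∈ S, e ∉ Z ∧ M.eRk (insert e Z) = (q : ℕ∞)}.ncard

/-- **Rule L's weight** of the pair `(Z, S)`: for a member `Z` inside the `Y`-set `S` — `1 / C(#S, q)` when `#S < p` (the LYM
split), `1 / eligCount S` when `#S ≥ p` and `Z` is eligible, and `0` otherwise. -/
noncomputable def ruleLWeight (M : Matroid α) (p q : ℕ) (Z S : Set α) : ℚ := by
  classical
  exact if Z ∈ cellMembers M p q ∧ Z ⊆ S ∧ S ∈ cellY M p q then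
    (if S.ncard < p then 1 / ((S.ncard.choose q : ℕ) : ℚ)
     else if ∃ e ∈ S, e ∉ Z ∧ M.eRk (insert e Z) = (q : ℕ∞) then 1 / ((eligCount M p q S : ℕ) : ℚ) else 0)
  else 0

/-- What the member `Z` receives under Rule L. -/
noncomputable def ruleLRecv (M : Matroid α) [M.Finite] (p q : ℕ) (Z : Set α) : ℚ :=
  ∑ S ∈ (cellY_finite M p q).toFinset, ruleLWeight M p q Z S

/-- **Rule L** for the cell `(p, q)` of `M` (a `Prop`; NOT asserted): every member receives at least `Φ(p,q)`. -/
def RuleLUp (M : Matroid α) [M.Finite] (p q : ℕ) : Prop :=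
  ∀ Z ∈ cellMembers M p q, phiK p q ≤ ruleLRecv M p q Z

omit [M.Finite] in
/-- Rule L's weights are non-negative. -/
theorem ruleLWeight_nonneg (p q : ℕ) (Z S : Set α) : 0 ≤ ruleLWeight M p q Z S := by
  unfold ruleLWeight
  split_ifs <;> positivity

omit [M.Finite] in
/-- Rule L's weights are supported on the pairs `Z ⊆ S`. -/
theorem subset_of_ruleLWeight_ne_zero (p q : ℕ) (Z S : Set α) (h : ruleLWeight M p q Z S ≠ 0) : Z ⊆ S := by
  unfold ruleLWeight at h
  by_contra hZS
  apply h
  rw [if_neg]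
  intro hc
  exact hZS hc.2.1

/-- At the tight layer every member is a `q`-set. -/
theorem ncard_eq_q_of_mem_cellMembers_tight {p q : ℕ} (hE : M.E.ncard = p + q) {Z : Set α} (hZ : Z ∈ cellMembers M p q) :
    Z.ncard = q := by
  obtain ⟨-, hAcard⟩ := compl_indep_of_mem_U M hE hZ
  have hEfin : M.E.Finite := M.set_finite M.E
  have h := ncard_sdiff_add_ncard_of_subset hZ.1 hEfin
  omega

/-- At the tight layer a finite set `S` contains at most `C(#S, q)` members (they are `q`-subsets of `S`). -/
theorem ncard_members_subset_le_choose {p q : ℕ} (hE : M.E.ncard = p + q) {S : Set α} (hS : S ⊆ M.E) :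
    {Z : Set α | Z ∈ cellMembers M p q ∧ Z ⊆ S}.ncard ≤ S.ncard.choose q := by
  classical
  have hEfin : M.E.Finite := M.set_finite M.E
  have hSfin : S.Finite := hEfin.subset hS
  set Sf : Finset α := hSfin.toFinset with hSf
  have hScard : Sf.card = S.ncard := (ncard_eq_toFinset_card _ hSfin).symm
  -- the target family: the q-subsets of S, as sets
  set P : Set (Set α) := (((Sf.powersetCard q).image (fun T : Finset α => (T : Set α)) : Finset (Set α)) : Set (Set α))
    with hP
  have hPcard : P.ncard = S.ncard.choose q := by
    rw [hP, ncard_coe_finset, Finset.card_image_of_injective _ Finset.coe_injective, Finset.card_powersetCard, hScard]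
  rw [← hPcard]
  refine Set.ncard_le_ncard ?_ (Set.toFinite _)
  intro Z hZ
  obtain ⟨hZm, hZS⟩ := hZ
  have hZfin : Z.Finite := hSfin.subset hZS
  rw [hP, Finset.coe_image]
  refine ⟨hZfin.toFinset, ?_, by simp⟩
  rw [Finset.mem_coe, Finset.mem_powersetCard]
  refine ⟨?_, ?_⟩
  · intro x hx
    rw [hZfin.mem_toFinset] at hx
    rw [hSf, hSfin.mem_toFinset]
    exact hZS hx
  · rw [← ncard_eq_toFinset_card _ hZfin]
    exact ncard_eq_q_of_mem_cellMembers_tight M hE hZm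

/-- The members contain at most `C(#S, q)` of themselves inside a middle-level set, so the LYM split loads `S` at most `1`;
a big set splits one unit among its eligible members: **every `Y`-set is loaded at most `1` under Rule L** (tight layer). -/
theorem ruleLWeight_load_le_one {p q : ℕ} (hE : M.E.ncard = p + q) (S : Set α) (hS : S ∈ cellY M p q) :
    ∑ Z ∈ (cellMembers_finite M p q).toFinset, ruleLWeight M p q Z S ≤ 1 := by
  classical
  set Mf : Finset (Set α) := (cellMembers_finite M p q).toFinset with hMf
  have hmem : ∀ Z, Z ∈ Mf ↔ Z ∈ cellMembers M p q := fun Z => by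
    rw [hMf, (cellMembers_finite M p q).mem_toFinset]
  by_cases hsmall : S.ncard < p
  · -- the LYM split
    have hw : ∀ Z ∈ Mf, ruleLWeight M p q Z S =
        if Z ⊆ S then 1 / ((S.ncard.choose q : ℕ) : ℚ) else 0 := by
      intro Z hZ
      rw [hmem] at hZ
      unfold ruleLWeight
      by_cases hZS : Z ⊆ S
      · rw [if_pos ⟨hZ, hZS, hS⟩, if_pos hsmall, if_pos hZS]
      · rw [if_neg (fun hc => hZS hc.2.1), if_neg hZS]
    rw [Finset.sum_congr rfl hw, Finset.sum_ite, Finset.sum_const_zero, add_zero, Finset.sum_const, nsmul_eq_mul]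
    have hcount : (Mf.filter (fun Z => Z ⊆ S)).card ≤ S.ncard.choose q := by
      have h := ncard_members_subset_le_choose M hE hS.1
      have heq : {Z : Set α | Z ∈ cellMembers M p q ∧ Z ⊆ S} = ((Mf.filter (fun Z => Z ⊆ S) : Finset (Set α)) : Set (Set α)) := by
        ext Z
        rw [Finset.coe_filter, Set.mem_setOf_eq, Set.mem_setOf_eq, hmem]
      rw [heq, ncard_coe_finset] at h
      exact h
    have hpos : (0 : ℚ) < ((S.ncard.choose q : ℕ) : ℚ) := by
      have hq : q ≤ S.ncard := by
        -- `S ∈ Y` has rank `> q`, hence more than `q` elements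
        have hEfin : M.E.Finite := M.set_finite M.E
        have hSfin : S.Finite := hEfin.subset hS.1
        have h1 := hS.2.1
        have h2 := M.eRk_le_encard S
        rw [← hSfin.cast_ncard_eq] at h2
        have h3 : (q : ℕ∞) < (S.ncard : ℕ∞) := lt_of_lt_of_le h1 h2
        exact_mod_cast h3.le
      exact_mod_cast Nat.choose_pos hq
    rw [mul_one_div, div_le_one hpos]
    exact_mod_cast hcount
  · -- the big sets: one unit among the eligible members
    have hw : ∀ Z ∈ Mf, ruleLWeight M p q Z S =
        if (Z ⊆ S ∧ ∃ e ∈ S, e ∉ Z ∧ M.eRk (insert e Z) = (q : ℕ∞)) then 1 / ((eligCount M p q S : ℕ) : ℚ) else 0 := by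
      intro Z hZ
      rw [hmem] at hZ
      unfold ruleLWeight
      by_cases hZS : Z ⊆ S
      · rw [if_pos ⟨hZ, hZS, hS⟩, if_neg hsmall]
        by_cases hel : ∃ e ∈ S, e ∉ Z ∧ M.eRk (insert e Z) = (q : ℕ∞)
        · rw [if_pos hel, if_pos ⟨hZS, hel⟩]
        · rw [if_neg hel, if_neg (fun hc => hel hc.2)]
      · rw [if_neg (fun hc => hZS hc.2.1), if_neg (fun hc => hZS hc.1)]
    rw [Finset.sum_congr rfl hw, Finset.sum_ite, Finset.sum_const_zero, add_zero, Finset.sum_const, nsmul_eq_mul]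
    have hcount : (Mf.filter (fun Z => Z ⊆ S ∧ ∃ e ∈ S, e ∉ Z ∧ M.eRk (insert e Z) = (q : ℕ∞))).card
        = eligCount M p q S := by
      unfold eligCount
      have heq : {Z : Set α | Z ∈ cellMembers M p q ∧ Z ⊆ S ∧ ∃ e ∈ S, e ∉ Z ∧ M.eRk (insert e Z) = (q : ℕ∞)} =
          ((Mf.filter (fun Z => Z ⊆ S ∧ ∃ e ∈ S, e ∉ Z ∧ M.eRk (insert e Z) = (q : ℕ∞)) : Finset (Set α)) :
            Set (Set α)) := by
        ext Z
        rw [Finset.coe_filter, Set.mem_setOf_eq, Set.mem_setOf_eq, hmem]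
      rw [heq, ncard_coe_finset]
    rw [hcount]
    rcases Nat.eq_zero_or_pos (eligCount M p q S) with h0 | hpos
    · rw [h0]
      simp
    · have hposq : (0 : ℚ) < ((eligCount M p q S : ℕ) : ℚ) := by exact_mod_cast hpos
      rw [mul_one_div, div_self (ne_of_gt hposq)]

/-- **C-044, UP FORM, AT THE TIGHT LAYER FROM RULE L**: `#E = p + q` and `RuleLUp M p q` ⇒ every family `𝒜` of members has at
least `Φ(p,q)·#𝒜` UP-neighbours. -/
theorem hallUp_of_ncard_eq_of_ruleL (p q : ℕ) (hE : M.E.ncard = p + q) (h : RuleLUp M p q) (𝒜 : Set (Set α))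
    (h𝒜 : 𝒜 ⊆ cellMembers M p q) :
    phiK p q * (𝒜.ncard : ℚ) ≤ ((upNbhd M p q 𝒜).ncard : ℚ) :=
  hallUp_of_fracMatching M p q (ruleLWeight M p q) (ruleLWeight_nonneg M p q) (subset_of_ruleLWeight_ne_zero M p q)
    (fun Z hZ => h Z hZ) (fun S hS => ruleLWeight_load_le_one M hE S hS) 𝒜 h𝒜

/-- Rule Q is an instance of the general double count (the equal split as a weight). -/
theorem hallUp_of_ruleQ' (p q : ℕ) (h : RuleQUp M p q) (𝒜 : Set (Set α)) (h𝒜 : 𝒜 ⊆ cellMembers M p q) :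
    phiK p q * (𝒜.ncard : ℚ) ≤ ((upNbhd M p q 𝒜).ncard : ℚ) :=
  hallUp_of_ruleQ M p q h 𝒜 h𝒜

end PercRepro
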